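import Summits.BirchSwinnertonDyer.BirchSwinnertonDyer.Theses.VerticalContact
import Summits.BirchSwinnertonDyer.BirchSwinnertonDyer.Theses.SelmerRank
import Literature.NumberTheory.EllipticCurves.OpenImage
import Literature.NumberTheory.EllipticCurves.BSDSelmerSkinnerProofs
import Literature.NumberTheory.EllipticCurves.SupersingularDensityProofs

/-!
# Redirect census r1 for crux `VerticalContact` (stmt-BirchSwinnertonDyer-18130)

Kernel-checked evidence for STRATEGY-CENSUS.md (r1), all sorry-free:

* `SelmerRankUBMult` — the ONLY consequence of `VerticalContact` that the route's deciding theorem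
  `Theses.VerticalContact.closes` consumes (it is literally the type of its internal `hUBmult`).
* `selmerRankUBMult_of_crux` — `VerticalContact ∧ VerticalSelmerBound ∧ TwistRankLeOne ⊢ SelmerRankUBMult`
  (the `hUBmult` block of `closes`, verbatim).
* `bsd_of_selmerRankUBMult` — `SelmerRankUBMult ∧ SelmerRankShaPFinite ∧ SelmerRankLB ∧ PGSelmerBSD ⊢ BSD`
  (the rest of `closes`, verbatim): so `closes` FACTORS through `SelmerRankUBMult`.
* `closes_factors` — the factorisation reassembled (same type as `closes`).
* `selmerRankUBMult_of_selmerRankUBR2` — modulo Serre's open image theorem (named fact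
  `serre_open_image`, Serre 1972 §4.2 Thm 2) the EXISTING crux `SelmerRank.SelmerRankUBR2`
  (stmt-BirchSwinnertonDyer-0484) implies `SelmerRankUBMult`, using two proved tree theorems:
  a multiplicative prime excludes CM (`not_hasCM_of_hasMultiplicativeReductionAtPrime'`) and every
  E/ℚ has infinitely many good ordinary primes (`infinite_goodOrdinaryPrimes_holds`).
* `bsd_of_selmerRankUBR2` — hence route SelmerRank's UB crux + this route's other items already
  decide BSD (mod Serre): the BSD-content of `VerticalContact` inside `closes` is dominated by 0484.
-/

namespace Summit.BirchSwinnertonDyer.BirchSwinnertonDyer.Cruxes.VerticalContact.Redirect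

open Summit.BirchSwinnertonDyer.BirchSwinnertonDyer.Theses.VerticalContact

/-- Selmer-corank upper bound at SOME admissible big-image good ordinary prime, for every globally
minimal E/ℚ with a prime of multiplicative reduction: the type of `closes.hUBmult`. -/
def SelmerRankUBMult : Prop :=
  ∀ (V : WeierstrassCurve ℚ) [V.IsElliptic] [V.IsGloballyMinimal],
    (∃ (q : ℕ) (_ : Fact q.Prime), V.HasMultiplicativeReductionAtPrime q) →
    ∃ (p : ℕ) (_ : Fact p.Prime), 5 ≤ p ∧ V.HasGoodReductionAtPrime p ∧ ¬ (p : ℤ) ∣ V.frobeniusTrace p ∧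
      V.HasSurjectiveModNGaloisRep p ∧ V.selmerCorank p ≤ V.analyticRank

/-- The crux (with the Selmer leaf and the GZK twist support) yields `SelmerRankUBMult` — this is
`closes.hUBmult` verbatim, and it is the only place `closes` touches `VerticalContact`. -/
theorem selmerRankUBMult_of_crux (hC : VerticalContact) (hB : VerticalSelmerBound)
    (hTw : TwistRankLeOne) : SelmerRankUBMult := by
  intro V _ _ hm
  obtain ⟨p, hp, K, hFK, hNK, Nplus, Nminus, a, b, O, ψ, I₁, a₀, α, m, C, hData, ⟨h2m, htw⟩, hN⟩ :=
    hC V hm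
  obtain ⟨C', hC'⟩ := hB V p K Nplus Nminus a b O ψ I₁ a₀ α hData
  obtain ⟨⟨h5, hgood, hord, hsurj, -, -⟩, -⟩ := hData
  refine ⟨p, hp, h5, hgood, hord, hsurj, ?_⟩
  obtain ⟨F, hFF, hNF, hA, 𝔓, ι, e, e', k, lam, Φ, hFdata, hForm, hBnd⟩ := hN (C + C')
  obtain ⟨I₀, hI₀, hpt, e₀, he₀, j, hQ, hj⟩ := hC' F 𝔓 ι e e' hFdata (C + C') k lam Φ hForm
  have hjle : j ≤ 2 * m * (C + C' + 1) + C := hBnd I₀ hI₀ hpt e₀ he₀ j hQ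
  have hσle : V.selmerCorank p + (V.quadraticTwist (NumberField.discr K : ℚ)).selmerCorank p ≤ 2 * m := by
    by_contra hcon
    have h1 : 2 * m + 1 ≤ V.selmerCorank p + (V.quadraticTwist (NumberField.discr K : ℚ)).selmerCorank p := by
      omega
    have h2 := Nat.mul_le_mul_left (C + C' + 1) h1
    nlinarith
  have hd : (NumberField.discr K : ℚ) ≠ 0 := by exact_mod_cast NumberField.discr_ne_zero K
  haveI := V.isElliptic_quadraticTwist hd
  have htw' := hTw (V.quadraticTwist (NumberField.discr K : ℚ)) p htw
  omega

/-- `SelmerRankUBMult` together with the route's OTHER items decides BSD — the remainder of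
`closes` verbatim (Greenberg identity, Ш[p^∞]-finite ⇒ shaCorank 0, transport T1–T3,
`selmerCorank_identity_imp_thesis_imp_bsd`). -/
theorem bsd_of_selmerRankUBMult (hUBmult : SelmerRankUBMult) (hSha : SelmerRankShaPFinite)
    (hLB : SelmerRankLB) (hPG : PGSelmerBSD) : _root_.BirchSwinnertonDyer := by
  have hId : ∀ (W : WeierstrassCurve ℚ), W.selmerCorank_eq_mordellWeilRank_add :=
    fun W => W.selmerCorank_eq_mordellWeilRank_add_holds
  have hZ : ∀ (W : WeierstrassCurve ℚ) [W.IsElliptic] (p : ℕ) [Fact p.Prime],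
      Finite ↥(AddCommGroup.primaryComponent W.sha p) → W.shaCorank p = 0 :=
    Literature.BSD.shaCorank_eq_zero_of_finite
  have hMW : ∀ (W : WeierstrassCurve ℚ) (C : WeierstrassCurve.VariableChange ℚ),
      (C • W).mordellWeilRank = W.mordellWeilRank := fun W C =>
    @WeierstrassCurve.VariableChange.finrank_point_variableChange ℚ _ W C (Classical.decEq ℚ)
  have hloc : ∀ (R : Type) [CommRing R] [IsDomain R] [IsDiscreteValuationRing R]
      (K : Type) [Field K] [Algebra R K] [IsFractionRing R K]
      (W : WeierstrassCurve K) [W.IsElliptic] (C : WeierstrassCurve.VariableChange K),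
      (C • W).localEulerFactor R = W.localEulerFactor R := by
    intro R _ _ _ K _ _ _ W _ C
    obtain ⟨D, hD⟩ : ∃ D : WeierstrassCurve.VariableChange K,
        (C • W).minimal R = D • W.minimal R :=
      ⟨((C • W).exists_isMinimal R).choose * C * ((W.exists_isMinimal R).choose)⁻¹, by
        rw [WeierstrassCurve.minimal, WeierstrassCurve.minimal, mul_smul, mul_smul, inv_smul_smul]⟩
    haveI hE : (W.minimal R).IsElliptic := by rw [WeierstrassCurve.minimal]; infer_instance
    have hΔ : (W.minimal R).Δ ≠ 0 := (W.minimal R).isUnit_Δ.ne_zero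
    have hgood : ((C • W).minimal R).HasGoodReduction R ↔ (W.minimal R).HasGoodReduction R := by
      rw [WeierstrassCurve.hasGoodReduction_iff, WeierstrassCurve.hasGoodReduction_iff,
        WeierstrassCurve.valuation_Δ_eq_of_isMinimal_of_eq_smul R hD]
      exact and_congr_left' ⟨fun _ => inferInstance, fun _ => inferInstance⟩
    have hcard : Nat.card (((C • W).minimal R).reduction R).toAffine.Point =
        Nat.card ((W.minimal R).reduction R).toAffine.Point := by
      obtain ⟨E, hE⟩ := WeierstrassCurve.exists_reduction_eq_smul R hD hΔ
      rw [hE]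
      exact WeierstrassCurve.natCard_point_smul _ _
    have hpoly : (C • W).localPolynomial R = W.localPolynomial R := by
      classical
      unfold WeierstrassCurve.localPolynomial
      simp only [hgood, hcard,
        WeierstrassCurve.hasSplitMultiplicativeReduction_iff_of_isMinimal_of_eq_smul R hD hΔ,
        WeierstrassCurve.hasMultiplicativeReduction_iff_of_isMinimal_of_eq_smul R hD hΔ]
    simp only [WeierstrassCurve.localEulerFactor, WeierstrassCurve.localPowerSeries, hpoly]
  have hAn : ∀ (W : WeierstrassCurve ℚ) [W.IsElliptic] (C : WeierstrassCurve.VariableChange ℚ),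
      (C • W).analyticRank = W.analyticRank := by
    intro W _ C
    have hL : (C • W).LFunction = W.LFunction := by
      unfold WeierstrassCurve.LFunction
      congr 1
      funext v
      simp only [WeierstrassCurve.baseChange, ← WeierstrassCurve.map_variableChange]
      exact hloc _ _ _ _
    have hLS : (C • W).LSeries = W.LSeries := by
      funext s
      simp only [WeierstrassCurve.LSeries, hL]
    have hEC : (C • W).entireContinuations = W.entireContinuations := by
      simp only [WeierstrassCurve.entireContinuations, hLS]
    have hEL : (C • W).entireLFunction = W.entireLFunction := by
      unfold WeierstrassCurve.entireLFunction
      rw [hEC, hLS]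
    simp only [WeierstrassCurve.analyticRank, hEL]
  have hmin : ∀ (V : WeierstrassCurve ℚ) [V.IsElliptic] [V.IsGloballyMinimal],
      ∃ (p : ℕ) (_ : Fact p.Prime), V.selmerCorank p = V.analyticRank := by
    intro V _ _
    by_cases hm : ∃ (q : ℕ) (_ : Fact q.Prime), V.HasMultiplicativeReductionAtPrime q
    · obtain ⟨p, hp, h5, hgood, hord, hsurj, hUB⟩ := hUBmult V hm
      exact ⟨p, hp, le_antisymm hUB (hLB V p h5 hgood hord hsurj)⟩
    · exact hPG V hm
  refine Literature.BSD.selmerCorank_identity_imp_thesis_imp_bsd hId ?_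
  intro W _
  obtain ⟨C, hC⟩ := WeierstrassCurve.hasGlobalMinimalModel_rat_holds W
  obtain ⟨p, hp, hminp⟩ := hmin (C • W)
  refine ⟨p, hp.out, ?_, hZ W p (hSha W p)⟩
  have h1 : W.selmerCorank p = W.mordellWeilRank + W.shaCorank p := hId W p
  have h2 : (C • W).selmerCorank p = (C • W).mordellWeilRank + (C • W).shaCorank p := hId (C • W) p
  have h3 : W.shaCorank p = 0 := hZ W p (hSha W p)
  have h4 : (C • W).shaCorank p = 0 := hZ (C • W) p (hSha (C • W) p)
  have h6 := hMW W C
  have h7 := hAn W C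
  omega

/-- `closes` factors through `SelmerRankUBMult` (same type as `Theses.VerticalContact.closes`). -/
theorem closes_factors (hC : VerticalContact) (hB : VerticalSelmerBound) (hSha : SelmerRankShaPFinite)
    (hLB : SelmerRankLB) (hPG : PGSelmerBSD) (hTw : TwistRankLeOne) : _root_.BirchSwinnertonDyer :=
  bsd_of_selmerRankUBMult (selmerRankUBMult_of_crux hC hB hTw) hSha hLB hPG

/-- DOMINATION: modulo Serre's open image theorem (named Literature fact), route SelmerRank's
existing UB crux `SelmerRankUBR2` (stmt-BirchSwinnertonDyer-0484) implies `SelmerRankUBMult`: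
a multiplicative prime rules out CM (tree theorem), Serre gives surjectivity of ρ̄_{E,p} for all
p ≥ p₀, and the tree theorem `infinite_goodOrdinaryPrimes_holds` supplies a good ordinary
p > max p₀ 4. -/
theorem selmerRankUBMult_of_selmerRankUBR2
    (hS : Literature.NumberTheory.EllipticCurves.serre_open_image)
    (hUB : Summit.BirchSwinnertonDyer.BirchSwinnertonDyer.Theses.SelmerRank.SelmerRankUBR2) :
    SelmerRankUBMult := by
  intro V _ _ hm
  obtain ⟨q, hq, hmult⟩ := hm
  have hCM : ¬ V.HasCM :=
    Literature.NumberTheory.EllipticCurves.not_hasCM_of_hasMultiplicativeReductionAtPrime' V hmult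
  obtain ⟨p₀, hp₀⟩ := hS V hCM
  obtain ⟨p, ⟨hp, hgood, hord⟩, hgt⟩ :=
    (WeierstrassCurve.infinite_goodOrdinaryPrimes_holds V).exists_gt (max p₀ 4)
  have h5 : 5 ≤ p := by
    have := le_max_right p₀ 4
    omega
  have hsurj : V.HasSurjectiveModNGaloisRep p :=
    hp₀ p hp.out (le_trans (le_max_left _ _) hgt.le)
  exact ⟨p, hp, h5, hgood, hord, hsurj, hUB V p h5 hgood hord hsurj⟩

/-- Consequence: mod Serre, route SelmerRank's UB crux with THIS route's remaining items already
decides BSD — `VerticalContact`'s contribution to `closes` is dominated by stmt-0484. -/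
theorem bsd_of_selmerRankUBR2
    (hS : Literature.NumberTheory.EllipticCurves.serre_open_image)
    (hUB : Summit.BirchSwinnertonDyer.BirchSwinnertonDyer.Theses.SelmerRank.SelmerRankUBR2)
    (hSha : SelmerRankShaPFinite) (hLB : SelmerRankLB) (hPG : PGSelmerBSD) :
    _root_.BirchSwinnertonDyer :=
  bsd_of_selmerRankUBMult (selmerRankUBMult_of_selmerRankUBR2 hS hUB) hSha hLB hPG

end Summit.BirchSwinnertonDyer.BirchSwinnertonDyer.Cruxes.VerticalContact.Redirect
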